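import Summits.ValiantsHypothesis.ValiantsHypothesis.Theorems.KPlusLogSqLawOctaveNewtonCellsSharp

/-!
# Route «KPlusLogSqLaw», octave door — line «newton-cells», part 4: PRODUCT LOCALITY of true Newton breakpoints; the COMMUTING (diagonal) SECTOR of K1♯ (sorry-free)

HONEST FRAMING.  Support file `--supports stmt-ValiantsHypothesis-19561` (crux `WeakLifting`, OPEN; door Ω-W = stmt-ValiantsHypothesis-24457, OPEN),
ideator lineage val-idea-1 (g7: the one typed follow-up left by the g4 handoff of the line «newton-cells»).  STRUCTURE tier: it decides the candidate
law K1♯ `NewtonCellLaw` (DEFINED in `…OctaveNewtonCells`, NOT asserted) on the DIAGONAL sector only, with a polynomial budget; it proves nothing about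
`NewtonCellLaw`, `NewtonCellLifting`, `OctaveWeakLifting`, `WeakLifting`, `TropicalB`, `MatrixDescartes` or Conjecture B in general (all OPEN); VP ≠ VNP
is not moved.  The obstruction to K1♯ on the line card (MASKED POCKETS) needs NON-commuting letters — this file prices the sector where the lever works.

* `newtonBreaks_mul_near` (**product locality**; the archimedean shadow of Dumas' exact additivity of non-archimedean Newton polygons under products):
  every breakpoint of the TRUE Newton polygon of `p * q` is within `5` (in `θ = log₂|x|`) of a breakpoint of `p` or of `q`, for ALL real `p, q`.
  Proof: at a slope `θ` farther than `5` from all breakpoints of `p` and `q` the top exponents `e₀`, `f₀` dominate STEEPLY (`steep_of_far` =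
  contrapositive of the scaled envelope gap `exists_break_near`): every other weight `|c_t|·2^{tθ}` is below `2^{-5|t−e₀|}` of the top one, so
  the others sum to ≤ `1/8` of it (`sum_half_pow_dist_le`); in `p·q` the exponent `e₀+f₀` then weighs ≥ `47/64·P·Q` and every other exponent
  ≤ the off-diagonal mass `≤ 17/64·P·Q` — `e₀+f₀` is the unique top exponent at `θ`, which is therefore no breakpoint.  The constant `5` is not
  load-bearing downstream (any absolute radius feeds only the multiplicative constants below).
* `card_newtonCells_le_of_near`, `card_newtonCells_mul_le : #cells(p·q) ≤ 11·(#breaks p + #breaks q)`, `newtonBreaks_prod_near`,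
  `card_newtonCells_prod_le : #cells(∏_{i∈s} fᵢ) ≤ (10|s|+1)·Σᵢ #breaks fᵢ`; `card_newtonBreaks_le : #breaks ≤ #terms − 1` (`top_mono`).
* `pencilDet_diagonal` (det of a DIAGONAL pencil = product of its entry `K`-nomials) and the headline `card_newtonCells_pencilDet_diagonal_le :
  V₁(det of a diagonal (m,K) pencil) ≤ (10m+1)·(m(K−1))`, in budget form `card_newtonCells_pencilDet_diagonal_le_pow : … ≤ 2^{8(K+⌊log₂m⌋²)}` —
  K1♯ on the diagonal sector with `C = 8` (pairwise commuting symmetric letters reduce to this by one orthogonal congruence; not typed here).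

References (background; the file is elementary and self-contained): G. Dumas, J. Math. Pures Appl. (6) 2 (1906) (Newton polygon of a product =
Minkowski sum, non-archimedean); A. Ostrowski, Acta Math. 72 (1940) (Graeffe / archimedean root–slope dictionary with absolute constants); K. Purbhoo,
«A Nullstellensatz for amoebas», Duke Math. J. 141 (2008), arXiv:math/0603201 (lopsidedness). [folklore]
-/

set_option linter.dupNamespace false
set_option autoImplicit false

namespace Summit.ValiantsHypothesis.ValiantsHypothesis.Theorems.KPlusLogSqLaw.Octave

open Polynomial Finset
open scoped BigOperators

/-! ### tops, steepness away from breakpoints, weights -/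

/-- a polynomial with at most one term has no Newton breakpoints. [folklore] -/
theorem newtonBreaks_eq_empty_of_card_support_le_one (p : ℝ[X]) (h : p.support.card ≤ 1) : newtonBreaks p = ∅ := by
  rw [Finset.eq_empty_iff_forall_notMem]
  intro b hb
  obtain ⟨u, v, hu, hv, huv, -, -⟩ := exists_tops_of_mem_newtonBreaks p hb
  have := Finset.card_le_one.1 h u hu v hv
  omega

/-- a nonzero polynomial has a top exponent at every slope. [folklore] -/
theorem exists_isTop (p : ℝ[X]) (hp : p ≠ 0) (θ : ℝ) : ∃ e₀ ∈ p.support, IsTop p e₀ θ := by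
  obtain ⟨e₀, he₀, hmax⟩ := exists_max_image p.support (fun t => newtonLog p t + t * θ) (support_nonempty.2 hp)
  exact ⟨e₀, he₀, fun t ht => hmax t ht⟩

/-- **steepness away from the breakpoints** (contrapositive of the scaled envelope gap `exists_break_near`): if every breakpoint of `p` is
farther than `c` from `θ`, the top exponent `e₀` at `θ` beats every other live exponent `t` by MORE than `c·|t − e₀|`. [folklore] -/
theorem steep_of_far (p : ℝ[X]) (θ c : ℝ) (e₀ : ℕ) (he₀ : e₀ ∈ p.support) (htop : IsTop p e₀ θ)
    (hfar : ∀ b ∈ newtonBreaks p, c < |θ - b|) :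
    ∀ t ∈ p.support, t ≠ e₀ → newtonLog p t + t * θ + c * |(t : ℝ) - e₀| < newtonLog p e₀ + e₀ * θ := by
  intro t ht hne
  by_contra hle
  obtain ⟨b, hb, hbd⟩ := exists_break_near p θ c e₀ t he₀ ht hne htop (not_lt.1 hle)
  exact absurd hbd (not_le.2 (hfar b hb))

/-- `|t − e|` for naturals, in truncated arithmetic. [folklore] -/
theorem abs_natCast_sub_eq (t e : ℕ) : |(t : ℝ) - e| = ((t - e + (e - t) : ℕ) : ℝ) := by
  rcases le_total t e with h | h
  · rw [Nat.sub_eq_zero_of_le h, zero_add, Nat.cast_sub h, abs_sub_comm]; exact abs_of_nonneg (sub_nonneg.2 (by exact_mod_cast h))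
  · rw [Nat.sub_eq_zero_of_le h, add_zero, Nat.cast_sub h]; exact abs_of_nonneg (sub_nonneg.2 (by exact_mod_cast h))

/-- `log₂` of the WEIGHT `|c_t|·(2^θ)^t` of a live exponent is its Newton line `newtonLog p t + tθ`. [folklore] -/
theorem logb_weight (p : ℝ[X]) (θ : ℝ) (t : ℕ) (ht : t ∈ p.support) :
    Real.logb 2 (|p.coeff t| * ((2 : ℝ) ^ θ) ^ t) = newtonLog p t + t * θ := by
  have hc : |p.coeff t| ≠ 0 := abs_ne_zero.2 (mem_support_iff.1 ht)
  rw [Real.logb_mul hc (pow_pos (Real.rpow_pos_of_pos two_pos θ) t).ne', Real.logb_pow, Real.logb_rpow two_pos (by norm_num), newtonLog]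

/-- weights of live exponents are positive. [folklore] -/
theorem weight_pos (p : ℝ[X]) (θ : ℝ) (t : ℕ) (ht : t ∈ p.support) : 0 < |p.coeff t| * ((2 : ℝ) ^ θ) ^ t :=
  mul_pos (abs_pos.2 (mem_support_iff.1 ht)) (pow_pos (Real.rpow_pos_of_pos two_pos θ) t)

/-- comparison of Newton lines = comparison of weights. [folklore] -/
theorem weight_le_weight_iff (p q : ℝ[X]) (θ : ℝ) (s t : ℕ) (hs : s ∈ p.support) (ht : t ∈ q.support) :
    |p.coeff s| * ((2 : ℝ) ^ θ) ^ s ≤ |q.coeff t| * ((2 : ℝ) ^ θ) ^ t ↔ newtonLog p s + s * θ ≤ newtonLog q t + t * θ := by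
  rw [← logb_weight p θ s hs, ← logb_weight q θ t ht]
  exact (Real.logb_le_logb one_lt_two (weight_pos p θ s hs) (weight_pos q θ t ht)).symm

/-- weighted steepness: a live exponent beaten by more than `5|t − e₀|` weighs at most `(1/2)^{5|t−e₀|}` of the top weight. [folklore] -/
theorem weight_le_of_steep (p : ℝ[X]) (θ : ℝ) (e₀ t : ℕ) (he₀ : e₀ ∈ p.support) (ht : t ∈ p.support)
    (hst : newtonLog p t + t * θ + 5 * |(t : ℝ) - e₀| < newtonLog p e₀ + e₀ * θ) :
    |p.coeff t| * ((2 : ℝ) ^ θ) ^ t ≤ (1 / 2 : ℝ) ^ (5 * (t - e₀ + (e₀ - t))) * (|p.coeff e₀| * ((2 : ℝ) ^ θ) ^ e₀) := by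
  set D := t - e₀ + (e₀ - t) with hD
  set A := |p.coeff t| * ((2 : ℝ) ^ θ) ^ t with hA
  set B := |p.coeff e₀| * ((2 : ℝ) ^ θ) ^ e₀ with hB
  have hApos : 0 < A := weight_pos p θ t ht
  have hBpos : 0 < B := weight_pos p θ e₀ he₀
  have h2pos : (0 : ℝ) < (2 : ℝ) ^ (5 * D) := pow_pos two_pos _
  have hlog : Real.logb 2 (A * (2 : ℝ) ^ (5 * D)) < Real.logb 2 B := by
    rw [Real.logb_mul hApos.ne' h2pos.ne', Real.logb_pow, Real.logb_self_eq_one one_lt_two, hA, hB, logb_weight p θ t ht,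
      logb_weight p θ e₀ he₀]
    have : ((5 * D : ℕ) : ℝ) * 1 = 5 * |(t : ℝ) - e₀| := by rw [show |(t : ℝ) - e₀| = (D : ℝ) from abs_natCast_sub_eq t e₀]; push_cast; ring
    linarith
  have hlt : A * (2 : ℝ) ^ (5 * D) < B := (Real.logb_lt_logb_iff one_lt_two (mul_pos hApos h2pos) hBpos).1 hlog
  have hhalf : (1 / 2 : ℝ) ^ (5 * D) * (2 : ℝ) ^ (5 * D) = 1 := by rw [← mul_pow]; norm_num
  calc A = (1 / 2 : ℝ) ^ (5 * D) * (A * (2 : ℝ) ^ (5 * D)) := by rw [mul_comm A, ← mul_assoc, hhalf, one_mul]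
    _ ≤ (1 / 2 : ℝ) ^ (5 * D) * B := mul_le_mul_of_nonneg_left hlt.le (by positivity)

/-- away from its breakpoints a polynomial is dominated by its top term: the other weights sum to at most `1/8` of the top weight
(`(1/2)^{5|t−e₀|} ≤ (1/2)^{|t−e₀|+1}/8`, and the scaled weights sum to at most one, `sum_half_pow_dist_le`). [folklore] -/
theorem sum_weight_erase_le (p : ℝ[X]) (θ : ℝ) (e₀ : ℕ) (he₀ : e₀ ∈ p.support)
    (hst : ∀ t ∈ p.support, t ≠ e₀ → newtonLog p t + t * θ + 5 * |(t : ℝ) - e₀| < newtonLog p e₀ + e₀ * θ) :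
    ∑ t ∈ p.support.erase e₀, |p.coeff t| * ((2 : ℝ) ^ θ) ^ t ≤ 1 / 8 * (|p.coeff e₀| * ((2 : ℝ) ^ θ) ^ e₀) := by
  set B := |p.coeff e₀| * ((2 : ℝ) ^ θ) ^ e₀ with hB
  have hB0 : 0 ≤ B := (weight_pos p θ e₀ he₀).le
  have hterm : ∀ t ∈ p.support.erase e₀, |p.coeff t| * ((2 : ℝ) ^ θ) ^ t ≤ (1 / 2 : ℝ) ^ (t - e₀ + (e₀ - t) + 1) * (1 / 8 * B) := by
    intro t ht
    have hts : t ∈ p.support := mem_of_mem_erase ht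
    have h1 : |p.coeff t| * ((2 : ℝ) ^ θ) ^ t ≤ (1 / 2 : ℝ) ^ (5 * (t - e₀ + (e₀ - t))) * B :=
      weight_le_of_steep p θ e₀ t he₀ hts (hst t hts (ne_of_mem_erase ht))
    have hD : 1 ≤ t - e₀ + (e₀ - t) := by have := ne_of_mem_erase ht; omega
    have h2 : (1 / 2 : ℝ) ^ (5 * (t - e₀ + (e₀ - t))) ≤ (1 / 2 : ℝ) ^ (t - e₀ + (e₀ - t) + 1 + 3) :=
      pow_le_pow_of_le_one (by norm_num) (by norm_num) (by omega)
    calc |p.coeff t| * ((2 : ℝ) ^ θ) ^ t ≤ (1 / 2 : ℝ) ^ (5 * (t - e₀ + (e₀ - t))) * B := h1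
      _ ≤ (1 / 2 : ℝ) ^ (t - e₀ + (e₀ - t) + 1 + 3) * B := mul_le_mul_of_nonneg_right h2 hB0
      _ = (1 / 2 : ℝ) ^ (t - e₀ + (e₀ - t) + 1) * (1 / 8 * B) := by rw [pow_add]; ring
  calc ∑ t ∈ p.support.erase e₀, |p.coeff t| * ((2 : ℝ) ^ θ) ^ t
      ≤ ∑ t ∈ p.support.erase e₀, (1 / 2 : ℝ) ^ (t - e₀ + (e₀ - t) + 1) * (1 / 8 * B) := sum_le_sum hterm
    _ = (∑ t ∈ p.support.erase e₀, (1 / 2 : ℝ) ^ (t - e₀ + (e₀ - t) + 1)) * (1 / 8 * B) := by rw [sum_mul]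
    _ ≤ 1 * (1 / 8 * B) := mul_le_mul_of_nonneg_right (sum_half_pow_dist_le _ e₀ (notMem_erase e₀ _)) (by positivity)
    _ = 1 / 8 * B := one_mul _

/-! ### product locality of true Newton breakpoints -/

/-- **PRODUCT LOCALITY of the true archimedean Newton polygon.**  Every breakpoint of the Newton polygon of `p * q` lies within `5` (in the
slope variable `θ = log₂|x|`) of a breakpoint of `p` or of `q` — for all real polynomials, no hypothesis (the non-archimedean statement is
Dumas' exact additivity; the archimedean error is an absolute constant). [folklore] -/
theorem newtonBreaks_mul_near (p q : ℝ[X]) : ∀ b ∈ newtonBreaks (p * q), ∃ b' ∈ newtonBreaks p ∪ newtonBreaks q, |b - b'| ≤ 5 := by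
  classical
  intro θ hθ
  have hpq : p * q ≠ 0 := by
    intro h
    rw [h, newtonBreaks_eq_empty_of_card_support_le_one 0 (by simp)] at hθ
    exact notMem_empty θ hθ
  by_contra hcon
  push Not at hcon
  obtain ⟨e₀, he₀, htp⟩ := exists_isTop p (left_ne_zero_of_mul hpq) θ
  obtain ⟨f₀, hf₀, htq⟩ := exists_isTop q (right_ne_zero_of_mul hpq) θ
  have hsp := steep_of_far p θ 5 e₀ he₀ htp fun b hb => hcon b (mem_union_left _ hb)
  have hsq := steep_of_far q θ 5 f₀ hf₀ htq fun b hb => hcon b (mem_union_right _ hb)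
  -- weights at slope `θ`: tops `P`, `Q`, the rest `A ≤ P/8`, `B ≤ Q/8`
  set y : ℝ := (2 : ℝ) ^ θ with hy_def
  have hy : 0 < y := Real.rpow_pos_of_pos two_pos θ
  have hwp0 : ∀ t, 0 ≤ |p.coeff t| * y ^ t := fun t => by positivity
  have hwq0 : ∀ t, 0 ≤ |q.coeff t| * y ^ t := fun t => by positivity
  set P := |p.coeff e₀| * y ^ e₀ with hP_def
  set Q := |q.coeff f₀| * y ^ f₀ with hQ_def
  have hP : 0 < P := weight_pos p θ e₀ he₀
  have hQ : 0 < Q := weight_pos q θ f₀ hf₀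
  set A := ∑ t ∈ p.support.erase e₀, |p.coeff t| * y ^ t with hA_def
  set B := ∑ t ∈ q.support.erase f₀, |q.coeff t| * y ^ t with hB_def
  have hA0 : 0 ≤ A := sum_nonneg fun t _ => hwp0 t
  have hB0 : 0 ≤ B := sum_nonneg fun t _ => hwq0 t
  have hA : A ≤ 1 / 8 * P := sum_weight_erase_le p θ e₀ he₀ hsp
  have hB : B ≤ 1 / 8 * Q := sum_weight_erase_le q θ f₀ hf₀ hsq
  -- the off-diagonal mass of the product: `OFF = (P+A)(Q+B) − PQ ≤ 17/64·PQ`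
  set OFF := ∑ x ∈ (p.support ×ˢ q.support).erase (e₀, f₀), |p.coeff x.1| * y ^ x.1 * (|q.coeff x.2| * y ^ x.2) with hOFF_def
  have hOFF : OFF ≤ 17 / 64 * (P * Q) := by
    have hfull : ∑ x ∈ p.support ×ˢ q.support, |p.coeff x.1| * y ^ x.1 * (|q.coeff x.2| * y ^ x.2)
        = (∑ s ∈ p.support, |p.coeff s| * y ^ s) * ∑ t ∈ q.support, |q.coeff t| * y ^ t := by rw [sum_product, sum_mul_sum]
    have h1 : ∑ s ∈ p.support, |p.coeff s| * y ^ s = P + A := (add_sum_erase _ _ he₀).symm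
    have h2 : ∑ t ∈ q.support, |q.coeff t| * y ^ t = Q + B := (add_sum_erase _ _ hf₀).symm
    have hmem0 : (e₀, f₀) ∈ p.support ×ˢ q.support := mem_product.2 ⟨he₀, hf₀⟩
    have h3 : P * Q + OFF = ∑ x ∈ p.support ×ˢ q.support, |p.coeff x.1| * y ^ x.1 * (|q.coeff x.2| * y ^ x.2) := by
      rw [hP_def, hQ_def, hOFF_def]
      exact add_sum_erase (p.support ×ˢ q.support) (fun x : ℕ × ℕ => |p.coeff x.1| * y ^ x.1 * (|q.coeff x.2| * y ^ x.2)) hmem0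
    have h4 : P * Q + OFF = (P + A) * (Q + B) := by rw [h3, hfull, h1, h2]
    have hAB : A * B ≤ (1 / 8 * P) * (1 / 8 * Q) := mul_le_mul hA hB hB0 (by positivity)
    have hPB : P * B ≤ P * (1 / 8 * Q) := mul_le_mul_of_nonneg_left hB hP.le
    have hAQ : A * Q ≤ (1 / 8 * P) * Q := mul_le_mul_of_nonneg_right hA hQ.le
    have h5 : OFF = P * B + A * Q + A * B := by linear_combination h4
    rw [h5]
    linarith
  -- a sum of product weights over pairs avoiding `(e₀, f₀)` is at most `OFF` (dead pairs weigh zero)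
  have hsub_le : ∀ s : Finset (ℕ × ℕ), (e₀, f₀) ∉ s → ∑ x ∈ s, |p.coeff x.1| * y ^ x.1 * (|q.coeff x.2| * y ^ x.2) ≤ OFF := by
    intro s hs
    have h1 : ∑ x ∈ s, |p.coeff x.1| * y ^ x.1 * (|q.coeff x.2| * y ^ x.2)
        = ∑ x ∈ s.filter (fun x => x ∈ p.support ×ˢ q.support), |p.coeff x.1| * y ^ x.1 * (|q.coeff x.2| * y ^ x.2) := by
      rw [sum_filter]
      refine sum_congr rfl fun x _ => ?_
      split_ifs with hmem
      · rfl
      · rw [mem_product, not_and_or, notMem_support_iff, notMem_support_iff] at hmem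
        rcases hmem with h | h <;> simp [h]
    rw [h1, hOFF_def]
    refine sum_le_sum_of_subset_of_nonneg (fun x hx => ?_) (fun x _ _ => mul_nonneg (hwp0 x.1) (hwq0 x.2))
    rw [mem_filter] at hx
    exact mem_erase.2 ⟨fun hxe => hs (hxe ▸ hx.1), hx.2⟩
  -- the weighted triangle inequality on (a part of) the Cauchy product
  have htri : ∀ (s : Finset (ℕ × ℕ)) (n : ℕ), (∀ x ∈ s, x.1 + x.2 = n) →
      |∑ x ∈ s, p.coeff x.1 * q.coeff x.2| * y ^ n ≤ ∑ x ∈ s, |p.coeff x.1| * y ^ x.1 * (|q.coeff x.2| * y ^ x.2) := by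
    intro s n hsn
    calc |∑ x ∈ s, p.coeff x.1 * q.coeff x.2| * y ^ n ≤ (∑ x ∈ s, |p.coeff x.1 * q.coeff x.2|) * y ^ n :=
          mul_le_mul_of_nonneg_right (abs_sum_le_sum_abs _ _) (pow_nonneg hy.le n)
      _ = ∑ x ∈ s, |p.coeff x.1| * y ^ x.1 * (|q.coeff x.2| * y ^ x.2) := by
          rw [sum_mul]
          refine sum_congr rfl fun x hx => ?_
          rw [abs_mul, ← hsn x hx, pow_add]; ring
  -- (i) an exponent other than `e₀ + f₀` weighs at most `OFF`
  have hcoef_le : ∀ n : ℕ, n ≠ e₀ + f₀ → |(p * q).coeff n| * y ^ n ≤ OFF := by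
    intro n hn
    rw [coeff_mul]
    refine (htri _ n fun x hx => by simpa using hx).trans (hsub_le _ fun hmem => hn ?_)
    have : (e₀, f₀).1 + (e₀, f₀).2 = n := by simpa using hmem
    simpa using this.symm
  -- (ii) the exponent `e₀ + f₀` weighs at least `P·Q − OFF`, hence is live
  have hcoef_ge : P * Q - OFF ≤ |(p * q).coeff (e₀ + f₀)| * y ^ (e₀ + f₀) := by
    have hmem : (e₀, f₀) ∈ antidiagonal (e₀ + f₀) := by simp
    set R := ∑ x ∈ (antidiagonal (e₀ + f₀)).erase (e₀, f₀), p.coeff x.1 * q.coeff x.2 with hR_def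
    have hsplit : (p * q).coeff (e₀ + f₀) = p.coeff e₀ * q.coeff f₀ + R := by rw [coeff_mul, ← add_sum_erase _ _ hmem]
    have hR : |R| * y ^ (e₀ + f₀) ≤ OFF :=
      (htri _ (e₀ + f₀) fun x hx => by simpa using mem_of_mem_erase hx).trans (hsub_le _ (notMem_erase _ _))
    have hPQ : |p.coeff e₀ * q.coeff f₀| * y ^ (e₀ + f₀) = P * Q := by rw [abs_mul, pow_add]; ring
    have habs : |p.coeff e₀ * q.coeff f₀| - |R| ≤ |(p * q).coeff (e₀ + f₀)| := by
      have := abs_sub_abs_le_abs_sub (p.coeff e₀ * q.coeff f₀) (-R)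
      rwa [abs_neg, sub_neg_eq_add, ← hsplit] at this
    have := mul_le_mul_of_nonneg_right habs (pow_nonneg hy.le (e₀ + f₀))
    rw [sub_mul, hPQ] at this
    linarith
  have hPQpos : 0 < P * Q := mul_pos hP hQ
  have hlive : e₀ + f₀ ∈ (p * q).support := by
    refine mem_support_iff.2 fun h0 => ?_
    have : |(p * q).coeff (e₀ + f₀)| * y ^ (e₀ + f₀) = 0 := by rw [h0]; simp
    linarith
  -- (iii) so `e₀ + f₀` is the UNIQUE top exponent of `p * q` at `θ`; but a breakpoint carries two tops
  obtain ⟨u, v, hu, hv, huv, htu, htv⟩ := exists_tops_of_mem_newtonBreaks (p * q) hθ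
  obtain ⟨n₀, hn₀, hn₀ne, htn₀⟩ : ∃ n₀ ∈ (p * q).support, n₀ ≠ e₀ + f₀ ∧ IsTop (p * q) n₀ θ := by
    by_cases hue : u = e₀ + f₀
    · exact ⟨v, hv, fun h => absurd (hue.trans h.symm) huv.ne, htv⟩
    · exact ⟨u, hu, hue, htu⟩
  have htop : |(p * q).coeff (e₀ + f₀)| * y ^ (e₀ + f₀) ≤ |(p * q).coeff n₀| * y ^ n₀ :=
    (weight_le_weight_iff (p * q) (p * q) θ (e₀ + f₀) n₀ hlive hn₀).2 (by exact_mod_cast htn₀ (e₀ + f₀) hlive)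
  linarith [hcoef_le n₀ hn₀ne]

/-! ### cell counts of products; breakpoints never outnumber terms -/

/-- cells within `R` of a finite set `B` of abscissae number at most `(2R+1)·#B`. [folklore] -/
theorem card_newtonCells_le_of_near (r : ℝ[X]) (B : Finset ℝ) (R : ℕ) (h : ∀ b ∈ newtonBreaks r, ∃ b' ∈ B, |b - b'| ≤ R) :
    (newtonCells r).card ≤ (2 * R + 1) * B.card := by
  classical
  have hsub : newtonCells r ⊆ B.biUnion (fun b' => Finset.Icc (⌊b'⌋ - R) (⌊b'⌋ + R)) := by
    intro c hc
    rw [newtonCells, mem_image] at hc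
    obtain ⟨b, hb, rfl⟩ := hc
    obtain ⟨b', hb', hbb'⟩ := h b hb
    rw [abs_le] at hbb'
    refine mem_biUnion.2 ⟨b', hb', mem_Icc.2 ⟨?_, ?_⟩⟩
    · rw [Int.le_floor]; push_cast; linarith [Int.floor_le b', hbb'.1]
    · rw [Int.floor_le_iff]; push_cast; linarith [Int.lt_floor_add_one b', hbb'.2]
  calc (newtonCells r).card ≤ (B.biUnion (fun b' => Finset.Icc (⌊b'⌋ - R) (⌊b'⌋ + R))).card := card_le_card hsub
    _ ≤ ∑ b' ∈ B, (Finset.Icc (⌊b'⌋ - (R : ℤ)) (⌊b'⌋ + R)).card := card_biUnion_le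
    _ = ∑ b' ∈ B, (2 * R + 1) := sum_congr rfl fun b' _ => by rw [Int.card_Icc]; omega
    _ = (2 * R + 1) * B.card := by rw [sum_const, smul_eq_mul, mul_comm]

/-- **cells of a product**: `#cells(p·q) ≤ 11·(#breaks p + #breaks q)`. [folklore] -/
theorem card_newtonCells_mul_le (p q : ℝ[X]) : (newtonCells (p * q)).card ≤ 11 * ((newtonBreaks p).card + (newtonBreaks q).card) := by
  classical
  have h := card_newtonCells_le_of_near (p * q) (newtonBreaks p ∪ newtonBreaks q) 5 (fun b hb => by
    obtain ⟨b', hb', hd⟩ := newtonBreaks_mul_near p q b hb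
    exact ⟨b', hb', by exact_mod_cast hd⟩)
  exact h.trans (Nat.mul_le_mul (by norm_num) (card_union_le _ _))

/-- **breakpoints of a finite product**: every breakpoint of `∏_{i∈s} fᵢ` is within `5·|s|` of a breakpoint of some factor. [folklore] -/
theorem newtonBreaks_prod_near {ι : Type*} (s : Finset ι) (f : ι → ℝ[X]) :
    ∀ b ∈ newtonBreaks (∏ i ∈ s, f i), ∃ i ∈ s, ∃ b' ∈ newtonBreaks (f i), |b - b'| ≤ 5 * (s.card : ℝ) := by
  classical
  induction s using Finset.induction_on with
  | empty =>
    intro b hb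
    rw [prod_empty, newtonBreaks_eq_empty_of_card_support_le_one 1
      (by simpa using (Polynomial.card_support_C_mul_X_pow_le_one (c := (1 : ℝ)) (n := 0)))] at hb
    exact absurd hb (notMem_empty b)
  | insert a s ha ih =>
    intro b hb
    rw [prod_insert ha] at hb
    obtain ⟨b', hb', hbb'⟩ := newtonBreaks_mul_near (f a) (∏ i ∈ s, f i) b hb
    rw [card_insert_of_notMem ha]
    rcases mem_union.1 hb' with h | h
    · refine ⟨a, mem_insert_self a s, b', h, hbb'.trans ?_⟩
      push_cast
      linarith [(Nat.cast_nonneg s.card : (0 : ℝ) ≤ s.card)]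
    · obtain ⟨i, hi, b'', hb'', hd⟩ := ih b' h
      refine ⟨i, mem_insert_of_mem hi, b'', hb'', ?_⟩
      calc |b - b''| ≤ |b - b'| + |b' - b''| := abs_sub_le b b' b''
        _ ≤ 5 + 5 * (s.card : ℝ) := add_le_add hbb' hd
        _ = 5 * ((s.card + 1 : ℕ) : ℝ) := by push_cast; ring

/-- **cells of a finite product**: `#cells(∏_{i∈s} fᵢ) ≤ (10|s|+1) · Σᵢ #breaks fᵢ`. [folklore] -/
theorem card_newtonCells_prod_le {ι : Type*} (s : Finset ι) (f : ι → ℝ[X]) :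
    (newtonCells (∏ i ∈ s, f i)).card ≤ (10 * s.card + 1) * ∑ i ∈ s, (newtonBreaks (f i)).card := by
  classical
  have h := card_newtonCells_le_of_near (∏ i ∈ s, f i) (s.biUnion fun i => newtonBreaks (f i)) (5 * s.card) (fun b hb => by
    obtain ⟨i, hi, b', hb', hd⟩ := newtonBreaks_prod_near s f b hb
    exact ⟨b', mem_biUnion.2 ⟨i, hi, hb'⟩, by push_cast; exact hd⟩)
  exact h.trans (Nat.mul_le_mul (by omega) card_biUnion_le)

/-- **`#breaks ≤ #terms − 1`**: along the breakpoints, in increasing order, the LARGER top exponent is strictly increasing (`top_mono`)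
and never the least live exponent. [folklore] -/
theorem card_newtonBreaks_le (p : ℝ[X]) : (newtonBreaks p).card ≤ p.support.card - 1 := by
  classical
  rcases Nat.lt_or_ge p.support.card 2 with hsmall | hbig
  · rw [newtonBreaks_eq_empty_of_card_support_le_one p (by omega), card_empty]; exact Nat.zero_le _
  have hne : p.support.Nonempty := card_pos.1 (by omega)
  -- `u b < v b`: the two top exponents carried by the breakpoint `b`
  choose! u v hu hv huv htu htv using fun b (hb : b ∈ newtonBreaks p) => exists_tops_of_mem_newtonBreaks p hb
  have hmaps : ∀ b ∈ newtonBreaks p, v b ∈ p.support.erase (p.support.min' hne) := by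
    intro b hb
    refine mem_erase.2 ⟨fun hge => ?_, hv b hb⟩
    have : p.support.min' hne ≤ u b := min'_le _ _ (hu b hb)
    have := huv b hb
    omega
  have hinj : Set.InjOn v (newtonBreaks p : Set ℝ) := by
    intro b hb b' hb' hvv
    by_contra hne'
    rcases lt_or_gt_of_ne hne' with h | h
    · have := top_mono p (hv b hb) (hu b' hb') (htv b hb) (htu b' hb') h
      have := huv b' hb'
      omega
    · have := top_mono p (hv b' hb') (hu b hb) (htv b' hb') (htu b hb) h
      have := huv b hb
      omega
  calc (newtonBreaks p).card ≤ (p.support.erase (p.support.min' hne)).card := card_le_card_of_injOn v (fun b hb => hmaps b hb) hinj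
    _ = p.support.card - 1 := card_erase_of_mem (min'_mem _ _)

/-! ### the commuting (diagonal) sector of K1♯ -/

/-- a `K`-nomial with prescribed exponents has at most `K` terms. [folklore] -/
theorem card_support_knomial_le {K : ℕ} (d : Fin K → ℕ) (a : Fin K → ℝ) : (∑ l, C (a l) * X ^ d l : ℝ[X]).support.card ≤ K := by
  classical
  have hsub : (∑ l, C (a l) * X ^ d l : ℝ[X]).support ⊆ Finset.univ.image d := by
    intro n hn
    rw [mem_support_iff, finsetSum_coeff] at hn
    obtain ⟨l, -, hl⟩ := exists_ne_zero_of_sum_ne_zero hn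
    rw [coeff_C_mul_X_pow] at hl
    split_ifs at hl with h
    · exact mem_image.2 ⟨l, mem_univ _, h.symm⟩
    · exact absurd rfl hl
  calc (∑ l, C (a l) * X ^ d l : ℝ[X]).support.card ≤ (Finset.univ.image d).card := card_le_card hsub
    _ ≤ (Finset.univ : Finset (Fin K)).card := card_image_le
    _ = K := by rw [Finset.card_univ, Fintype.card_fin]

/-- **the determinant of a DIAGONAL pencil is the product of its entry `K`-nomials** `∑_l C(w l j)·X^{d l}`. [folklore] -/
theorem pencilDet_diagonal {m K : ℕ} (d : Fin K → ℕ) (w : Fin K → Fin m → ℝ) :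
    pencilDet d (fun l => Matrix.diagonal (w l)) = ∏ j, ∑ l, C (w l j) * X ^ d l := by
  unfold pencilDet
  have h : (∑ l, ((X : ℝ[X]) ^ d l) • (Matrix.diagonal (w l)).map C) = Matrix.diagonal (fun j => ∑ l, C (w l j) * X ^ d l) := by
    refine Matrix.ext fun i j => ?_
    simp only [Matrix.sum_apply, Matrix.smul_apply, Matrix.map_apply, Matrix.diagonal_apply, smul_eq_mul]
    split_ifs with hij
    · exact Finset.sum_congr rfl fun l _ => mul_comm _ _
    · simp
  rw [h, Matrix.det_diagonal]

/-- **K1♯ ON THE COMMUTING SECTOR (polynomial budget).**  The true Newton polygon of the determinant of a DIAGONAL real `(m, K)` pencil meets at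
most `(10m+1)·m·(K−1)` unit cells: the determinant is a product of `m` `K`-nomials (`pencilDet_diagonal`), each with at most `K − 1` breakpoints
(`card_newtonBreaks_le`), and product locality smears them over at most `10m+1` cells each (`card_newtonCells_prod_le`).  No symmetry, sign or
design hypothesis. [this file] -/
theorem card_newtonCells_pencilDet_diagonal_le {m K : ℕ} (d : Fin K → ℕ) (w : Fin K → Fin m → ℝ) :
    (newtonCells (pencilDet d (fun l => Matrix.diagonal (w l)))).card ≤ (10 * m + 1) * (m * (K - 1)) := by
  classical
  rw [pencilDet_diagonal]
  have h := card_newtonCells_prod_le (Finset.univ : Finset (Fin m)) (fun j => ∑ l, C (w l j) * X ^ d l)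
  rw [Finset.card_univ, Fintype.card_fin] at h
  refine h.trans (Nat.mul_le_mul_left _ ?_)
  calc ∑ j : Fin m, (newtonBreaks (∑ l, C (w l j) * X ^ d l)).card ≤ ∑ _j : Fin m, (K - 1) :=
        sum_le_sum fun j _ => (card_newtonBreaks_le _).trans (Nat.sub_le_sub_right (card_support_knomial_le d (fun l => w l j)) 1)
    _ = m * (K - 1) := by rw [sum_const, smul_eq_mul, Finset.card_univ, Fintype.card_fin]

/-- the diagonal budget is inside the K1♯ budget with `C = 8`: `(10m+1)·m·(K−1) ≤ 2^{8(K+⌊log₂m⌋²)}`. [folklore] -/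
theorem diagonal_budget_le_pow (m K : ℕ) : (10 * m + 1) * (m * (K - 1)) ≤ 2 ^ (8 * (K + Nat.log 2 m ^ 2)) := by
  rcases Nat.eq_zero_or_pos K with hK | hK
  · subst hK; simp
  set L := Nat.log 2 m with hL
  have hm : m < 2 ^ (L + 1) := Nat.lt_pow_succ_log_self one_lt_two m
  have hK2 : K - 1 < 2 ^ K := lt_of_le_of_lt (Nat.sub_le K 1) Nat.lt_two_pow_self
  have h2 : (10 * m + 1) * (m * (K - 1)) ≤ (2 ^ 4 * 2 ^ (L + 1)) * (2 ^ (L + 1) * 2 ^ K) :=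
    Nat.mul_le_mul (by omega) (Nat.mul_le_mul hm.le hK2.le)
  have h3 : (2 ^ 4 * 2 ^ (L + 1)) * (2 ^ (L + 1) * 2 ^ K) = 2 ^ (2 * L + K + 6) := by rw [← pow_add, ← pow_add, ← pow_add]; ring_nf
  have h4 : 2 * L + K + 6 ≤ 8 * (K + L ^ 2) := by
    rcases Nat.eq_zero_or_pos L with hL0 | hL0
    · rw [hL0]; omega
    · nlinarith
  calc (10 * m + 1) * (m * (K - 1)) ≤ (2 ^ 4 * 2 ^ (L + 1)) * (2 ^ (L + 1) * 2 ^ K) := h2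
    _ = 2 ^ (2 * L + K + 6) := h3
    _ ≤ 2 ^ (8 * (K + L ^ 2)) := Nat.pow_le_pow_right (by norm_num) h4

/-- **K1♯ `NewtonCellLaw` holds on the diagonal sector with `C = 8`** (the shape of the candidate law, restricted to diagonal letters; the general law
stays OPEN). [this file] -/
theorem card_newtonCells_pencilDet_diagonal_le_pow {m K : ℕ} (d : Fin K → ℕ) (w : Fin K → Fin m → ℝ) :
    (newtonCells (pencilDet d (fun l => Matrix.diagonal (w l)))).card ≤ 2 ^ (8 * (K + Nat.log 2 m ^ 2)) :=
  (card_newtonCells_pencilDet_diagonal_le d w).trans (diagonal_budget_le_pow m K)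

end Summit.ValiantsHypothesis.ValiantsHypothesis.Theorems.KPlusLogSqLaw.Octave
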